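import Summits.Ventures.HodgeRepro2.T5LevelIdempotent

/-!
# The level idempotent factors through a finite quotient (Tier-5 kernel support, seat p8)

The finite-group model of `e_K`: for a normal subgroup `H ◁ K` of finite index, the restriction
of `ρ` to `K` acts on the `H`-invariants `V^H` through the finite group `K ⧸ H`
(`quotientRep`), and on `V^H` the level average `e_K` of `T5LevelIdempotent` IS Mathlib's
finite-group averaging projector `Representation.averageMap` of that quotient representation
(`levelAverage_eq_averageMap`).  The invariants of the quotient representation are the
`K`-invariants (`mem_invariants_quotientRep_iff`).  Every smooth vector lies in such a `V^H`
(take `H` = the normal core of its stabiliser, `mem_invariants_normalCore`), so this is the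
sentence «the level-`K` action on smooth vectors factors through a finite quotient», on which
the finite-group averaging (Mathlib's `averageMap`) is then applied verbatim.
-/

namespace Summit.Ventures.HodgeRepro2.T5LevelIdempotentFinite

open Summit.Ventures.HodgeRepro2.LevelPositivity Summit.Ventures.HodgeRepro2.T5LevelIdempotent

variable {G : Type*} [Group G] {k : Type*} [Field k] {V : Type*} [AddCommGroup V] [Module k V]
  (ρ : Representation k G V) {K : Subgroup G} (H : Subgroup K) [H.Normal]

/-- `V^H` is stable under `K` when `H ◁ K`. -/
theorem apply_mem_invariants_of_normal (κ : K) {x : V} (hx : x ∈ invariants (restrict ρ K) H) :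
    ρ (κ : G) x ∈ invariants (restrict ρ K) H := by
  rw [mem_invariants_iff] at hx ⊢
  intro h hh
  have h' : κ⁻¹ * h * κ ∈ H := (‹H.Normal›).conj_mem' h hh κ
  have hx' : ρ ((κ⁻¹ * h * κ : K) : G) x = x := hx _ h'
  show ρ (h : G) (ρ (κ : G) x) = ρ (κ : G) x
  calc ρ (h : G) (ρ (κ : G) x) = ρ ((h * κ : K) : G) x := by
        rw [Subgroup.coe_mul, map_mul, Module.End.mul_apply]
    _ = ρ ((κ * (κ⁻¹ * h * κ) : K) : G) x := by
        congr 2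
        group
    _ = ρ (κ : G) (ρ ((κ⁻¹ * h * κ : K) : G) x) := by
        rw [Subgroup.coe_mul, map_mul, Module.End.mul_apply]
    _ = ρ (κ : G) x := by rw [hx']

/-- The restriction of `ρ` to `K`, acting on `V^H` (`H ◁ K`). -/
noncomputable def restrictInvariants : Representation k K (invariants (restrict ρ K) H) where
  toFun κ := (ρ (κ : G)).restrict (fun _ hx => apply_mem_invariants_of_normal ρ H κ hx)
  map_one' := by
    refine LinearMap.ext fun x => Subtype.ext ?_
    simp only [LinearMap.coe_restrict_apply, OneMemClass.coe_one, map_one, Module.End.one_apply]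
  map_mul' κ₁ κ₂ := by
    refine LinearMap.ext fun x => Subtype.ext ?_
    simp only [LinearMap.coe_restrict_apply, Subgroup.coe_mul, map_mul, Module.End.mul_apply]

/-- `restrictInvariants` acts as `ρ κ` on the underlying vector. -/
@[simp] theorem restrictInvariants_apply (κ : K) (x : invariants (restrict ρ K) H) :
    (restrictInvariants ρ H κ x : V) = ρ (κ : G) x :=
  rfl

/-- `H` acts trivially on `V^H`. -/
theorem le_ker_restrictInvariants : H ≤ (restrictInvariants ρ H).ker := by
  intro h hh
  rw [MonoidHom.mem_ker]
  refine LinearMap.ext fun x => Subtype.ext ?_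
  show ρ (h : G) (x : V) = (x : V)
  exact mem_invariants_iff.1 x.2 h hh

/-- The finite-group model: `K ⧸ H` acting on `V^H`. -/
noncomputable def quotientRep : Representation k (K ⧸ H) (invariants (restrict ρ K) H) :=
  QuotientGroup.lift H (restrictInvariants ρ H) (le_ker_restrictInvariants ρ H)

/-- `quotientRep` on the class of `κ` is `ρ κ`. -/
@[simp] theorem quotientRep_mk (κ : K) (x : invariants (restrict ρ K) H) :
    quotientRep ρ H (κ : K ⧸ H) x = restrictInvariants ρ H κ x := by
  simp only [quotientRep, QuotientGroup.lift_mk]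

/-- The invariants of the quotient representation are the `K`-invariants. -/
theorem mem_invariants_quotientRep_iff (x : invariants (restrict ρ K) H) :
    x ∈ (quotientRep ρ H).invariants ↔ (x : V) ∈ invariants ρ K := by
  rw [Representation.mem_invariants, mem_invariants_iff]
  constructor
  · intro h g hg
    have := congrArg Subtype.val (h ((⟨g, hg⟩ : K) : K ⧸ H))
    rwa [quotientRep_mk, restrictInvariants_apply] at this
  · intro h c
    obtain ⟨κ, rfl⟩ := QuotientGroup.mk_surjective c
    exact Subtype.ext (by rw [quotientRep_mk, restrictInvariants_apply]; exact h κ κ.2)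

/-- On `V^H`, the level average `e_K` is Mathlib's finite-group averaging projector of `K ⧸ H`. -/
theorem levelAverage_eq_averageMap [Fintype (K ⧸ H)] [Invertible (Fintype.card (K ⧸ H) : k)]
    {v : V} (hv : v ∈ invariants (restrict ρ K) H) :
    levelAverage ρ K v = (Representation.averageMap (quotientRep ρ H) ⟨v, hv⟩ : V) := by
  haveI : H.FiniteIndex := Subgroup.finiteIndex_of_finite_quotient
  have hH : H ≤ stabilizerIn ρ K v := fun h hh =>
    mem_stabilizerIn_iff.2 (mem_invariants_iff.1 hv h hh)
  have hcard : (H.index : k) = (Fintype.card (K ⧸ H) : k) := by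
    rw [Subgroup.index_eq_card, Nat.card_eq_fintype_card]
  have hk : (H.index : k) ≠ 0 := by
    rw [hcard]
    exact Invertible.ne_zero _
  rw [levelAverage_eq hH hk, Representation.averageMap, GroupAlgebra.average, map_smul, map_sum]
  simp only [Representation.asAlgebraHom_of]
  rw [LinearMap.smul_apply, LinearMap.sum_apply, Submodule.coe_smul, Submodule.coe_sum, invOf_eq_inv,
    hcard]
  congr 1
  unfold cosetSum
  rw [finsum_eq_sum_of_fintype]
  refine Finset.sum_congr rfl (fun c _ => ?_)
  obtain ⟨κ, rfl⟩ := QuotientGroup.mk_surjective c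
  rw [quotientRep_mk, restrictInvariants_apply, rep_eq hH κ]

/-- The same statement read from the finite-group side: on `V^H`, Mathlib's `averageMap` of the
quotient representation is `e_K`. -/
theorem averageMap_quotientRep_eq [Fintype (K ⧸ H)] [Invertible (Fintype.card (K ⧸ H) : k)]
    (x : invariants (restrict ρ K) H) :
    (Representation.averageMap (quotientRep ρ H) x : V) = levelAverage ρ K x :=
  (levelAverage_eq_averageMap ρ H x.2).symm

variable {ρ}

/-- Every vector is invariant under the normal core (in `K`) of its stabiliser. -/
theorem mem_invariants_normalCore (v : V) :
    v ∈ invariants (restrict ρ K) (stabilizerIn ρ K v).normalCore :=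
  mem_invariants_iff.2 fun _ hh => mem_stabilizerIn_iff.1 (Subgroup.normalCore_le _ hh)

/-- `e_K v` is the `K ⧸ N`-average of `v` on `V^N`, `N` the normal core of `K_v` — the level-`K`
action on a smooth vector factors through the finite quotient `K ⧸ N`. -/
theorem levelAverage_eq_averageMap_normalCore (v : V)
    [Fintype (K ⧸ (stabilizerIn ρ K v).normalCore)]
    [Invertible (Fintype.card (K ⧸ (stabilizerIn ρ K v).normalCore) : k)] :
    levelAverage ρ K v =
      (Representation.averageMap (quotientRep ρ (stabilizerIn ρ K v).normalCore)
        ⟨v, mem_invariants_normalCore v⟩ : V) :=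
  levelAverage_eq_averageMap ρ _ (mem_invariants_normalCore v)

/-- The quotient by the normal core of a finite-index stabiliser is finite (so a `Fintype`
instance exists, `Fintype.ofFinite`). -/
theorem finite_quotient_normalCore (v : V) [(stabilizerIn ρ K v).FiniteIndex] :
    Finite (K ⧸ (stabilizerIn ρ K v).normalCore) := by
  haveI : (stabilizerIn ρ K v).normalCore.FiniteIndex := Subgroup.finiteIndex_normalCore _
  exact Subgroup.finite_quotient_of_finiteIndex

/-- In characteristic `0` the cardinality of `K ⧸ N` is invertible in `k`
(`invertibleOfNonzero`), so `levelAverage_eq_averageMap_normalCore` applies to every vector with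
a finite-index stabiliser. -/
theorem card_quotient_normalCore_ne_zero [CharZero k] (v : V)
    [Fintype (K ⧸ (stabilizerIn ρ K v).normalCore)] :
    (Fintype.card (K ⧸ (stabilizerIn ρ K v).normalCore) : k) ≠ 0 :=
  Nat.cast_ne_zero.2 Fintype.card_ne_zero

end Summit.Ventures.HodgeRepro2.T5LevelIdempotentFinite
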